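import Summits.BirchSwinnertonDyer.BirchSwinnertonDyer.Theorems.ClassRecordThreeKernelUpper
import Summits.BirchSwinnertonDyer.BirchSwinnertonDyer.Theorems.ClassRecordThreeShimuraUpperHalf
import Summits.BirchSwinnertonDyer.BirchSwinnertonDyer.Theorems.ClassRecordThreeKolyGlue
import Summits.BirchSwinnertonDyer.BirchSwinnertonDyer.Theses.ClassRecordThree
import Summits.BirchSwinnertonDyer.BirchSwinnertonDyer.Theses.KolyvaginRoadThree
import HarnessLib

/-!
# Routes `ClassRecordThree` / `KolyvaginRoadThree` (rung K2@3): the `closes` terms with crux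
# `ShimuraDisplaysAtThree` (item 19110) CASHED IN for three published named facts
# (cell `bsd-stepL`, seat `bsd-stepL-shim-p1` g2; planner's SHIM cash-in package `plan/SHIM-CASHIN/PACKAGE.md`)

`--supports stmt-BirchSwinnertonDyer-19110`, HELPER (no route decl is closed: the conclusion is the rung leaf
`X11b.MultiplicativeRankOneAtThree`, the hypotheses are the routes' OTHER items plus named facts).

The two K2@3 route files consume the crux `ShimuraDisplaysAtThree` (`∀ W, ClassX11b W 3 → Ram W 3 → split at 3 →
¬ShapeAlpha W → ¬ShapeGamma W → 3 ∣ ∏c → X11b.P2ShimuraDisplaysAt W 3`) only through the kernels' binder `hSh`,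
i.e. only for the Euler-system half on the pure-(T2β)@3 sub-atom, which is the THEOREM
`classRecordThree_shimuraUpperHalfAtThree_of_published` (`Theorems/ClassRecordThreeShimuraUpperHalf.lean`, p422736)
from Jacquet–Langlands (`nonempty_shimuraParametrizationData`), Pasten 2024 §6
(`PastenShimura2024_ribetTakahashiPackage`) and Cai–Shu–Tian 2014 Thm. 1.5 + JSW 2017 Thm. 4.4.1
(`shimuraCurve_heegnerPoint_grossZagier_kolyvagin`) together with seven conjuncts of `PublishedInputsThree`.
With the kernels re-keyed on that consumed bound (`Theorems/ClassRecordThreeKernelUpper.lean`: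
`multiplicativeRankOneAtThree_of_classRecord_upper`, `multiplicativeRankOneAtThree_of_kolyRecord_upper`), the
routes' `closes` terms re-glue with the crux replaced by the conjunction of the three facts (the planner's
by-name support item `ShimuraCurveInputs`):

* `classRecordThree_multiplicativeRankOneAtThree_of_shimuraCurveInputs` — `ClassRecordThree.closes` re-glued;
* `kolyvaginRoadThree_multiplicativeRankOneAtThree_of_shimuraCurveInputs` — `KolyvaginRoadThree.closes` re-glued
  (A1 branch `Koly.bsdp_three_onA1_of_kolyvaginFrames`, as in the route file).

The planner's `--closes-file` for each route is the body of the corresponding theorem with `h₅`/`h₆ :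
ShimuraCurveInputs` (a def unfolding to the same conjunction). HONEST FRAMING: THEOREMS ONLY; no new
mathematics; CONDITIONAL on the items and the named facts (at `3 ∣ N⁺` the Kolyvagin conjunct is JSW Thm. 4.4.1
AS PRINTED — reading flag `JSW17-Thm441-Nekovar-primary`); nothing booked; O2 stays OPEN; BSD is not proved by
any of this.
-/

noncomputable section

open scoped Classical

open WeierstrassCurve NumberField IsDedekindDomain Field Literature.NumberTheory.EllipticCurves
  Rat.HeightOneSpectrum
  Literature.NumberTheory.EllipticCurves.ModularForms
  Literature.NumberTheory.EllipticCurves.Rank1Residual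
  Literature.NumberTheory.EllipticCurves.Rank1Residual.Typed
  Literature.NumberTheory.EllipticCurves.Wuthrich2014
  Literature.NumberTheory.EllipticCurves.Skinner2016
  Literature.NumberTheory.EllipticCurves.SteinWuthrich2013
  Literature.NumberTheory.EllipticCurves.Disegni2020
  Literature.NumberTheory.EllipticCurves.BarriosEtAl2025
  Literature.NumberTheory.Automorphic
  Literature.NumberTheory.GaloisRepresentations Literature.NumberTheory.GaloisCohomology
  Summit.BirchSwinnertonDyer.Rank1Residual
  Summit.BirchSwinnertonDyer.Rank1Residual.X11b
  Summit.BirchSwinnertonDyer.Rank1Residual.X11b.Three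

-- the cell's Theorems namespace repeats the summit name (Summit.<Summit>.<Problem>), as in every sibling file
set_option linter.dupNamespace false

namespace Summit.BirchSwinnertonDyer.BirchSwinnertonDyer.Theorems

/-! ### The two re-glued `closes` terms -/

/-- **Route `ClassRecordThree`: the re-glued `closes` with crux `ShimuraDisplaysAtThree` (item 19110) CASHED IN.**
The rung-K2@3 leaf `X11b.MultiplicativeRankOneAtThree` from the route's items `SchneiderAtThree`, `HalvesAtThree`,
`HsiehDescentAtThree`, `EulerHalvesAtThree`, `CornerAtThree`, `PublishedInputsThree` and — in place of the crux
`ShimuraDisplaysAtThree` — the conjunction of three PUBLISHED named facts of the tree (the planner's by-name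
support item `ShimuraCurveInputs`): Jacquet–Langlands `nonempty_shimuraParametrizationData`, Pasten 2024 §6
`PastenShimura2024_ribetTakahashiPackage`, Cai–Shu–Tian 2014 Thm. 1.5 + JSW 2017 Thm. 4.4.1
`shimuraCurve_heegnerPoint_grossZagier_kolyvagin`. Proof: `multiplicativeRankOneAtThree_of_classRecord_upper` with
`hUβ :=` `classRecordThree_shimuraUpperHalfAtThree_of_published` (p422736). This IS the `closes` term of the
planner's SHIM cash-in edit (`plan/SHIM-CASHIN/PACKAGE.md`). CONDITIONAL on the items; nothing booked; O2 OPEN;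
BSD is not proved by any of this. [folklore] -/
theorem classRecordThree_multiplicativeRankOneAtThree_of_shimuraCurveInputs
    (h₁ : Theses.ClassRecordThree.SchneiderAtThree) (h₂ : Theses.ClassRecordThree.HalvesAtThree)
    (h₃ : Theses.ClassRecordThree.HsiehDescentAtThree) (h₄ : Theses.ClassRecordThree.EulerHalvesAtThree)
    -- in place of (h₅ : ShimuraDisplaysAtThree): the three Shimura-curve named facts (`ShimuraCurveInputs`)
    (h₅ : nonempty_shimuraParametrizationData ∧ PastenShimura2024_ribetTakahashiPackage ∧
      shimuraCurve_heegnerPoint_grossZagier_kolyvagin)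
    (h₆ : Theses.ClassRecordThree.CornerAtThree) (h₇ : Theses.ClassRecordThree.PublishedInputsThree) :
    Summit.BirchSwinnertonDyer.Rank1Residual.X11b.MultiplicativeRankOneAtThree := by
  obtain ⟨hGZ, hKo, hB, hSk, hWu, hGZK, hmod, hnf, hHL, hMaz, hPT, hFH, hBR, hSkA, hJn, hHn, hD, hpar, hMN,
    hH⟩ := h₇
  obtain ⟨hJL, hRT, hHK⟩ := h₅
  exact multiplicativeRankOneAtThree_of_classRecord_upper hGZ hKo hB hSk hWu hGZK hmod hnf hHL hMaz hPT hSkA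
    hJn hHn hD hpar hMN hH h₁ (fun W _ _ hX ↦ (h₃ W hX).1) (fun W _ _ hX ↦ (h₃ W hX).2)
    (fun W _ _ hX ↦ (h₂ W hX).1) (fun W _ _ hX ↦ (h₂ W hX).2)
    (fun W _ _ hX hram _ hα hγ _ ↦
      classRecordThree_shimuraUpperHalfAtThree_of_published hSk hGZK hmod hnf hFH hMaz hBR hJL hRT hHK W hX
        hram hα hγ)
    (fun W _ _ hX ↦ (h₄ W hX).1) (fun W _ _ hX ↦ (h₄ W hX).2.1) (fun W _ _ hX ↦ (h₄ W hX).2.2)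
    (fun W _ _ ↦ (h₆ W).1) (fun W _ _ ↦ (h₆ W).2.1) (fun W _ _ ↦ (h₆ W).2.2)

/-- **Route `KolyvaginRoadThree`: the re-glued `closes` with crux `ShimuraDisplaysAtThree` CASHED IN.** The
rung-K2@3 leaf from the route's items `ZhangSharpFrameAtThree`, `SchneiderTamAtThree`, `HalvesTamAtThree`,
`HsiehDescentAtThree`, `EulerHalvesAtThree`, `CornerAtThree`, `PublishedInputsKolyThree` and, in place of
`ShimuraDisplaysAtThree`, the three Shimura-curve named facts (`ShimuraCurveInputs`). Proof: the route's own
`closes` term with `multiplicativeRankOneAtThree_of_kolyRecord_upper` for the hub and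
`classRecordThree_shimuraUpperHalfAtThree_of_published` (p422736) for `hUβ`; the A1 branch
`Koly.bsdp_three_onA1_of_kolyvaginFrames` as in the route file. CONDITIONAL on the items; nothing booked; O2 OPEN.
[folklore] -/
theorem kolyvaginRoadThree_multiplicativeRankOneAtThree_of_shimuraCurveInputs
    (h₁ : Theses.KolyvaginRoadThree.ZhangSharpFrameAtThree) (h₂ : Theses.KolyvaginRoadThree.SchneiderTamAtThree)
    (h₃ : Theses.KolyvaginRoadThree.HalvesTamAtThree) (h₄ : Theses.KolyvaginRoadThree.HsiehDescentAtThree)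
    (h₅ : Theses.KolyvaginRoadThree.EulerHalvesAtThree)
    -- in place of (h₆ : ShimuraDisplaysAtThree): the three Shimura-curve named facts (`ShimuraCurveInputs`)
    (h₆ : nonempty_shimuraParametrizationData ∧ PastenShimura2024_ribetTakahashiPackage ∧
      shimuraCurve_heegnerPoint_grossZagier_kolyvagin)
    (h₇ : Theses.KolyvaginRoadThree.CornerAtThree) (h₈ : Theses.KolyvaginRoadThree.PublishedInputsKolyThree) :
    Summit.BirchSwinnertonDyer.Rank1Residual.X11b.MultiplicativeRankOneAtThree := by
  obtain ⟨⟨hGZ, hKo, hB, hSk, hWu, hGZK, hmod, hnf, hHL, hMaz, hPT, hFH, hBR, hSkA, hJn, hHn, hD, hpar, hMN, hH⟩,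
    hMc, hrec, hKD⟩ := h₈
  obtain ⟨hJL, hRT, hHK⟩ := h₆
  exact multiplicativeRankOneAtThree_of_kolyRecord_upper hGZ hKo hB hSk hWu hGZK hmod hnf hHL hMaz hPT hSkA
    hJn hHn hD hpar hMN hH
    (fun W _ _ hX hram htam ↦
      Koly.bsdp_three_onA1_of_kolyvaginFrames hGZ hKo hB hSk hGZK hmod hnf hHL hMaz hrec hMc hKD h₁ W hX hram
        htam)
    h₂ (fun W _ _ hX ↦ (h₄ W hX).1) (fun W _ _ hX ↦ (h₃ W hX).1)
    (fun W _ _ hX hram _ hα hγ _ ↦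
      classRecordThree_shimuraUpperHalfAtThree_of_published hSk hGZK hmod hnf hFH hMaz hBR hJL hRT hHK W hX
        hram hα hγ)
    (fun W _ _ hX ↦ (h₅ W hX).1) (fun W _ _ hX ↦ (h₅ W hX).2.1)
    (fun W _ _ hX ↦ (h₄ W hX).2) (fun W _ _ hX ↦ (h₃ W hX).2) (fun W _ _ hX ↦ (h₅ W hX).2.2)
    (fun W _ _ ↦ (h₇ W).1) (fun W _ _ ↦ (h₇ W).2.1) (fun W _ _ ↦ (h₇ W).2.2)

end Summit.BirchSwinnertonDyer.BirchSwinnertonDyer.Theorems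

end
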